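import Literature.NumberTheory.Transcendental.EllipticKronecker
import Literature.NumberTheory.Transcendental.TwoCurvePeriods
import HarnessLib

/-!
# A Kronecker lemma for the product lattice `∏_b Λ_{cls b}` of pairwise non-isogenous lattices

Topic `Literature/NumberTheory/Transcendental`; unit
`provefact-Literature.NumberTheory.Transcendental.H-0a3eb64689` (fact
`Literature.NumberTheory.Transcendental.HuberWustholzManyCurvePeriods`, `ManyCurvePeriods.lean`).
It introduces NO named fact. Lattice-family counterpart of the one-lattice
`EllipticKronecker.lean` (`Kron.eq_zero_on_ratHull`, no complex multiplication): the arithmetic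
kernel of the classification of the obstruction subgroups of Philippon's zero estimate on the
`k`-lattice standard models `M = 𝔾ₘ^β × P` (`ManyCurveTheta.lean`), whose abelian part is
`∏_b E_{cls b}` for a finite family `L : 𝓙 → PeriodPair` of PAIRWISE NON-ISOGENOUS lattices and a
class map `cls : γ → 𝓙` whose CM classes carry at most one block.

  Let `g` be an entire function on `ℂ^γ` whose zero set is invariant under the product lattice
  `Λ_γ = ∏_b Λ_{cls b}`, vanishing on a complex subspace `𝔷`. Then `g` vanishes on the
  CLASSWISE RATIONAL HULL `ratHullCls cls 𝔷 = {z : ⟨c, z⟩ = 0 for all c ∈ ℚ^γ supported in ONE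
  class with ⟨c, 𝔷⟩ = 0}` (`KronFam.eq_zero_on_ratHullCls`)

— the analytic shadow of "the Zariski closure of a complex subtorus direction of `∏_b E_{cls b}`
is the abelian subvariety it generates, which is a product over the isotypic classes
(`Hom(E_i, E_j) = 0` for `i ≠ j`) of abelian subvarieties `{C_i z = 0}` of the `E_i^{cls⁻¹(i)}`
(`End E_i = ℤ` for the non-CM classes; a CM class has a single factor)". A rational relation
mixing two classes need NOT pass to the hull (the graph of `z ↦ z` in `ℂ²` projects onto
`E₁ × E₂`).

The proof is that of the one-lattice file verbatim (maximal subspace `W ⊇ 𝔷` of the zero set,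
coordinate complement, projection `P`, dichotomy on `P(Λ_γ)`: small elements give a new complex
line in the zero set by the identity theorem; uniform discreteness makes some `N ≥ 1` multiply
all the `P(ω_i(cls b) e_b)` into `Λ_γ`), except for the last step (`mem_of_forall_zRelCls`):
`x = N·P(e_b)_{b'}` satisfies `x Λ_{cls b} ⊆ Λ_{cls b'}`, so `x = 0` if `cls b ≠ cls b'`
(non-isogeny, `isIsogenousTo_of_mul_omega_mem`), `x ∈ ℤ` if `cls b = cls b'` has no CM
(`Kron.int_of_mul_omega_mem`), and `b = b'` if the class has CM; in every case the row `b'` of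
`P` yields rational relations of `W` supported in the class `cls b'`, whence
`ratHullCls 𝔷 ⊆ W`. The generic lemmas of `EllipticKronecker.lean` (`Kron.zRel`, `Kron.cspan`,
`Kron.exists_isCompl_cspan`, `Kron.exists_line_subset_closure`, `Kron.eq_zero_smul_of_real`,
`Kron.apply_eq_sum_mul`) are reused.

## References

* D. Bertrand, P. Philippon, *Sous-groupes algébriques de groupes algébriques commutatifs*,
  Illinois J. Math. 32 (1988), 263–280 (abelian subvarieties of products). [folklore]
* Yu. V. Nesterenko, P. Philippon (eds.), *Introduction to Algebraic Independence Theory*,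
  LNM 1752, Springer 2001, Ch. 11 (D. Roy), Thm. 4.1. [NesterenkoPhilippon2001]
* A. Huber, G. Wüstholz, *Transcendence and Linear Relations of 1-Periods*, Cambridge Tracts 227,
  CUP 2022, Thm. 15.3 (isotypic decomposition: `Hom(E_i, E_j) = 0`). [HuberWustholz2022]
-/

noncomputable section

open Complex Filter Topology Module

namespace Literature.NumberTheory.Transcendental

namespace KronFam

open Kron (zRel mem_zRel_iff zRel_antitone cspan single_mem_cspan apply_eq_zero_of_mem_cspan
  mem_cspan_of_support exists_isCompl_cspan exists_line_subset_closure eq_zero_smul_of_real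
  eq_sum_smul_single apply_eq_sum_mul)

variable {𝓙 : Type} (L : 𝓙 → PeriodPair) {γ : Type} [Fintype γ] [DecidableEq γ] (cls : γ → 𝓙)

/-! ### Non-isogeny: `xΛ ⊆ Λ'`, `x ≠ 0` is an isogeny -/

omit [Fintype γ] [DecidableEq γ] in
/-- **`Hom(Λ, Λ') = 0` for non-isogenous lattices**: if `xω₁, xω₂ ∈ Λ'` (periods of `Λ`) and
`x ≠ 0` then `Λ` and `Λ'` are isogenous. [folklore] -/
theorem isIsogenousTo_of_mul_omega_mem {Λ Λ' : PeriodPair} {x : ℂ} (hx : x ≠ 0)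
    (h1 : x * Λ.ω₁ ∈ Λ'.lattice) (h2 : x * Λ.ω₂ ∈ Λ'.lattice) : Λ.IsIsogenousTo Λ' := by
  refine ⟨x, hx, fun l hl => ?_⟩
  obtain ⟨m, n, rfl⟩ := PeriodPair.mem_lattice.mp hl
  have : x * (m * Λ.ω₁ + n * Λ.ω₂) = m * (x * Λ.ω₁) + n * (x * Λ.ω₂) := by ring
  rw [this]
  refine Λ'.lattice.add_mem ?_ ?_
  · simpa [zsmul_eq_mul] using Λ'.lattice.smul_mem m h1
  · simpa [zsmul_eq_mul] using Λ'.lattice.smul_mem n h2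

/-! ### Lattice vectors of the product lattice, the classwise rational hull -/

/-- The lattice vector `(m_b ω₁(Λ_{cls b}) + n_b ω₂(Λ_{cls b}))_b ∈ Λ_γ`. [folklore] -/
def latt (m n : γ → ℤ) : γ → ℂ := fun b => (m b : ℂ) * (L (cls b)).ω₁ + (n b : ℂ) * (L (cls b)).ω₂

omit [Fintype γ] [DecidableEq γ] in
/-- `Λ_γ` is closed under addition. [folklore] -/
theorem latt_add (m n m' n' : γ → ℤ) : latt L cls m n + latt L cls m' n' = latt L cls (m + m') (n + n') := by
  funext b; simp [latt]; ring

omit [Fintype γ] [DecidableEq γ] in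
/-- `Λ_γ` is closed under negation. [folklore] -/
theorem neg_latt (m n : γ → ℤ) : -latt L cls m n = latt L cls (-m) (-n) := by
  funext b; simp [latt]; ring

omit [Fintype γ] [DecidableEq γ] in
/-- Integer multiples of lattice vectors. [folklore] -/
theorem zsmul_latt (k : ℤ) (m n : γ → ℤ) : k • latt L cls m n = latt L cls (k • m) (k • n) := by
  funext b; simp [latt]; ring

omit [DecidableEq γ] in
/-- **The classwise rational hull** of `𝔷 ≤ ℂ^γ`: the complex subspace cut out by the rational
relations of `𝔷` supported in a single class (the Lie algebra of the smallest abelian subvariety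
of `∏_b E_{cls b}` containing `exp 𝔷`: a product over the classes). [folklore] -/
def ratHullCls (𝔷 : Submodule ℂ (γ → ℂ)) : Submodule ℂ (γ → ℂ) where
  carrier := {z | ∀ i : 𝓙, ∀ c ∈ zRel 𝔷, (∀ b, cls b ≠ i → c b = 0) → ∑ b, (c b : ℂ) * z b = 0}
  zero_mem' := fun i c _ _ => by simp
  add_mem' := by
    intro z z' hz hz' i c hc hci
    simp only [Pi.add_apply, mul_add, Finset.sum_add_distrib, hz i c hc hci, hz' i c hc hci, add_zero]
  smul_mem' := by
    intro a z hz i c hc hci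
    simp only [Pi.smul_apply, smul_eq_mul, mul_left_comm _ a, ← Finset.mul_sum, hz i c hc hci, mul_zero]

omit [DecidableEq γ] in
/-- Membership in the classwise rational hull. [folklore] -/
theorem mem_ratHullCls_iff {𝔷 : Submodule ℂ (γ → ℂ)} {z : γ → ℂ} :
    z ∈ ratHullCls cls 𝔷 ↔
      ∀ i : 𝓙, ∀ c ∈ zRel 𝔷, (∀ b, cls b ≠ i → c b = 0) → ∑ b, (c b : ℂ) * z b = 0 := Iff.rfl

omit [DecidableEq γ] in
/-- `𝔷 ≤ ratHullCls 𝔷`. [folklore] -/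
theorem le_ratHullCls (𝔷 : Submodule ℂ (γ → ℂ)) : 𝔷 ≤ ratHullCls cls 𝔷 := fun _ hz _ _ hc _ => hc _ hz

omit [DecidableEq γ] in
/-- The rational hull refines the classwise rational hull. [folklore] -/
theorem ratHull_le_ratHullCls (𝔷 : Submodule ℂ (γ → ℂ)) : Kron.ratHull 𝔷 ≤ ratHullCls cls 𝔷 :=
  fun _ hz _ c hc _ => hz c hc

omit [DecidableEq γ] in
/-- A subspace cut out by its classwise rational relations and containing `𝔷` contains
`ratHullCls 𝔷`. [folklore] -/
theorem ratHullCls_le_of_le {𝔷 W : Submodule ℂ (γ → ℂ)} (h : 𝔷 ≤ W)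
    (hW : ∀ z, (∀ i : 𝓙, ∀ c ∈ zRel W, (∀ b, cls b ≠ i → c b = 0) → ∑ b, (c b : ℂ) * z b = 0) → z ∈ W) :
    ratHullCls cls 𝔷 ≤ W :=
  fun z hz => hW z fun i c hc hci => hz i c (zRel_antitone h hc) hci

/-! ### Reduction modulo `Λ_γ` coordinatewise -/

/-- Integer parts of the first real coordinates (block `b` in the basis of `Λ_{cls b}`). [folklore] -/
def mfl (v : γ → ℂ) : γ → ℤ := fun b => ⌊(L (cls b)).basis.repr (v b) 0⌋

/-- Integer parts of the second real coordinates. [folklore] -/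
def nfl (v : γ → ℂ) : γ → ℤ := fun b => ⌊(L (cls b)).basis.repr (v b) 1⌋

/-- Reduction of every coordinate into the fundamental parallelogram of its lattice. [folklore] -/
def red (v : γ → ℂ) : γ → ℂ := v - latt L cls (mfl L cls v) (nfl L cls v)

omit [Fintype γ] [DecidableEq γ] in
/-- The reduced coordinates. [folklore] -/
theorem red_apply (v : γ → ℂ) (b : γ) :
    red L cls v b = ((Int.fract ((L (cls b)).basis.repr (v b) 0) : ℝ) : ℂ) * (L (cls b)).ω₁ +
      ((Int.fract ((L (cls b)).basis.repr (v b) 1) : ℝ) : ℂ) * (L (cls b)).ω₂ := by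
  simp only [red, Pi.sub_apply, latt, mfl, nfl, Int.fract]
  have h := Kron.repr_sum_eq (L (cls b)) (v b)
  push_cast
  linear_combination -h

/-- The bound for the reduced vectors. [folklore] -/
def redBound : ℝ := ∑ b : γ, (‖(L (cls b)).ω₁‖ + ‖(L (cls b)).ω₂‖)

omit [DecidableEq γ] in
/-- The bound is non-negative. [folklore] -/
theorem redBound_nonneg : 0 ≤ redBound L cls := Finset.sum_nonneg fun b _ => by positivity

omit [DecidableEq γ] in
/-- **The reduced vectors are bounded.** [folklore] -/
theorem norm_red_apply_le (v : γ → ℂ) (b : γ) : ‖red L cls v b‖ ≤ redBound L cls := by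
  have hb : ‖red L cls v b‖ ≤ ‖(L (cls b)).ω₁‖ + ‖(L (cls b)).ω₂‖ := by
    rw [red_apply]
    refine (norm_add_le _ _).trans (add_le_add ?_ ?_)
    · rw [norm_mul, Complex.norm_real, Real.norm_eq_abs, abs_of_nonneg (Int.fract_nonneg _)]
      exact mul_le_of_le_one_left (norm_nonneg _) (Int.fract_lt_one _).le
    · rw [norm_mul, Complex.norm_real, Real.norm_eq_abs, abs_of_nonneg (Int.fract_nonneg _)]
      exact mul_le_of_le_one_left (norm_nonneg _) (Int.fract_lt_one _).le
  exact hb.trans (Finset.single_le_sum (f := fun b : γ => ‖(L (cls b)).ω₁‖ + ‖(L (cls b)).ω₂‖)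
    (fun b _ => by positivity) (Finset.mem_univ b))

omit [DecidableEq γ] in
/-- The reduced vectors are bounded (sup norm). [folklore] -/
theorem norm_red_le (v : γ → ℂ) : ‖red L cls v‖ ≤ redBound L cls :=
  (pi_norm_le_iff_of_nonneg (redBound_nonneg L cls)).mpr fun b => norm_red_apply_le L cls v b

omit [Fintype γ] [DecidableEq γ] in
/-- A vanishing coordinate has vanishing integer parts. [folklore] -/
theorem mfl_eq_zero {v : γ → ℂ} {b : γ} (hv : v b = 0) : mfl L cls v b = 0 ∧ nfl L cls v b = 0 := by
  simp [mfl, nfl, hv]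

/-! ### The subgroup `P(Λ_γ)` -/

/-- The image of `Λ_γ` under a linear map, as an additive subgroup. [folklore] -/
def lattImage (P : (γ → ℂ) →ₗ[ℂ] (γ → ℂ)) : AddSubgroup (γ → ℂ) where
  carrier := {v | ∃ m n : γ → ℤ, v = P (latt L cls m n)}
  zero_mem' := ⟨0, 0, by
    have : latt L cls (0 : γ → ℤ) 0 = 0 := by funext b; simp [latt]
    rw [this, map_zero]⟩
  add_mem' := by
    rintro _ _ ⟨m, n, rfl⟩ ⟨m', n', rfl⟩
    exact ⟨m + m', n + n', by rw [← map_add, latt_add]⟩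
  neg_mem' := by
    rintro _ ⟨m, n, rfl⟩
    exact ⟨-m, -n, by rw [← map_neg, neg_latt]⟩

omit [Fintype γ] [DecidableEq γ] in
/-- Differences in `P(Λ_γ)`. [folklore] -/
theorem map_latt_sub (P : (γ → ℂ) →ₗ[ℂ] (γ → ℂ)) (m n m' n' : γ → ℤ) :
    P (latt L cls m n) - P (latt L cls m' n') = P (latt L cls (m - m') (n - n')) := by
  rw [← map_sub]
  congr 1
  funext b; simp [latt]; ring

omit [DecidableEq γ] in
/-- **Uniform discreteness gives finiteness of bounded parts.** [folklore] -/
theorem finite_lattImage_inter_ball (P : (γ → ℂ) →ₗ[ℂ] (γ → ℂ)) {ε : ℝ} (hε : 0 < ε)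
    (hUD : ∀ m n : γ → ℤ, ‖P (latt L cls m n)‖ < ε → P (latt L cls m n) = 0) (R : ℝ) :
    {v | v ∈ lattImage L cls P ∧ ‖v‖ ≤ R}.Finite := by
  by_contra hinf
  have hsub : {v | v ∈ lattImage L cls P ∧ ‖v‖ ≤ R} ⊆ Metric.closedBall (0 : γ → ℂ) R := fun v hv => by
    simpa using hv.2
  obtain ⟨x, -, hx⟩ := Set.Infinite.exists_accPt_of_subset_isCompact hinf (isCompact_closedBall 0 R) hsub
  rw [accPt_iff_nhds] at hx
  obtain ⟨y₁, ⟨hy₁U, hy₁T⟩, hy₁x⟩ := hx (Metric.ball x (ε / 2)) (Metric.ball_mem_nhds x (by positivity))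
  have hδ : 0 < dist y₁ x := dist_pos.mpr hy₁x
  obtain ⟨y₂, ⟨hy₂U, hy₂T⟩, -⟩ := hx (Metric.ball x (dist y₁ x)) (Metric.ball_mem_nhds x hδ)
  have hne : y₁ ≠ y₂ := by
    intro h; subst h
    exact (lt_irrefl _ (Metric.mem_ball.mp hy₂U))
  have hdist : dist y₁ y₂ < ε := by
    have h1 : dist y₁ x < ε / 2 := Metric.mem_ball.mp hy₁U
    have h2 : dist y₂ x < dist y₁ x := Metric.mem_ball.mp hy₂U
    calc dist y₁ y₂ ≤ dist y₁ x + dist y₂ x := dist_triangle_right _ _ _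
      _ < ε / 2 + ε / 2 := by linarith
      _ = ε := by ring
  obtain ⟨m₁, n₁, h₁⟩ := hy₁T.1
  obtain ⟨m₂, n₂, h₂⟩ := hy₂T.1
  have hsub' : y₁ - y₂ = P (latt L cls (m₁ - m₂) (n₁ - n₂)) := by rw [h₁, h₂, map_latt_sub]
  have h0 := hUD _ _ (by rw [← hsub', ← dist_eq_norm]; exact hdist)
  rw [← hsub', sub_eq_zero] at h0
  exact hne h0

/-- **Some multiple of each element of a uniformly discrete `P(Λ_γ)` is a lattice vector**, when
`P` is a projection onto a coordinate subspace (reduction into the fundamental parallelograms and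
pigeonhole). [folklore] -/
theorem exists_nsmul_eq_latt {W : Submodule ℂ (γ → ℂ)} {B : Finset γ} (hc : IsCompl (cspan B) W) {ε : ℝ} (hε : 0 < ε)
    (hUD : ∀ m n : γ → ℤ, ‖(cspan B).projection W hc (latt L cls m n)‖ < ε →
      (cspan B).projection W hc (latt L cls m n) = 0)
    {g : γ → ℂ} (hg : g ∈ lattImage L cls ((cspan B).projection W hc)) :
    ∃ d : ℕ, 0 < d ∧ ∃ m n : γ → ℤ, (d : ℤ) • g = latt L cls m n := by
  set P := (cspan B).projection W hc with hP
  -- reduction keeps `P(Λ_γ)` (lattice vectors supported on `B` are fixed by `P`)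
  have hredG : ∀ v ∈ lattImage L cls P, red L cls v ∈ lattImage L cls P := by
    intro v hv
    have hvB : v ∈ cspan B := by
      obtain ⟨m, n, rfl⟩ := hv
      exact Submodule.projection_apply_mem hc _
    have hsupp : latt L cls (mfl L cls v) (nfl L cls v) ∈ cspan B := by
      refine mem_cspan_of_support fun b hb => ?_
      obtain ⟨h1, h2⟩ := mfl_eq_zero L cls (apply_eq_zero_of_mem_cspan hvB hb)
      simp [latt, h1, h2]
    have hfix : P (latt L cls (mfl L cls v) (nfl L cls v)) = latt L cls (mfl L cls v) (nfl L cls v) :=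
      Submodule.projection_apply_of_mem_left hc hsupp
    have hmem : latt L cls (mfl L cls v) (nfl L cls v) ∈ lattImage L cls P := ⟨_, _, hfix.symm⟩
    exact (lattImage L cls P).sub_mem hv hmem
  -- pigeonhole on `k ↦ red (k • g)`
  have hfin := finite_lattImage_inter_ball L cls P hε hUD (redBound L cls)
  have hmaps : Set.MapsTo (fun k : ℕ => red L cls ((k : ℤ) • g)) Set.univ
      {v | v ∈ lattImage L cls P ∧ ‖v‖ ≤ redBound L cls} :=
    fun k _ => ⟨hredG _ ((lattImage L cls P).zsmul_mem hg k), norm_red_le L cls _⟩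
  obtain ⟨k₁, -, k₂, -, hk, heq⟩ := Set.infinite_univ.exists_ne_map_eq_of_mapsTo hmaps hfin
  -- `(k₁ - k₂) • g` is a lattice vector
  wlog hlt : k₂ < k₁ generalizing k₁ k₂
  · exact this k₂ k₁ hk.symm heq.symm (lt_of_le_of_ne (not_lt.mp hlt) hk)
  refine ⟨k₁ - k₂, Nat.sub_pos_of_lt hlt, mfl L cls ((k₁ : ℤ) • g) - mfl L cls ((k₂ : ℤ) • g),
    nfl L cls ((k₁ : ℤ) • g) - nfl L cls ((k₂ : ℤ) • g), ?_⟩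
  have h : (k₁ : ℤ) • g - latt L cls (mfl L cls ((k₁ : ℤ) • g)) (nfl L cls ((k₁ : ℤ) • g)) =
      (k₂ : ℤ) • g - latt L cls (mfl L cls ((k₂ : ℤ) • g)) (nfl L cls ((k₂ : ℤ) • g)) := heq
  have hlatt : latt L cls (mfl L cls ((k₁ : ℤ) • g)) (nfl L cls ((k₁ : ℤ) • g)) -
      latt L cls (mfl L cls ((k₂ : ℤ) • g)) (nfl L cls ((k₂ : ℤ) • g)) =
      latt L cls (mfl L cls ((k₁ : ℤ) • g) - mfl L cls ((k₂ : ℤ) • g))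
        (nfl L cls ((k₁ : ℤ) • g) - nfl L cls ((k₂ : ℤ) • g)) := by
    funext b; simp [latt]; ring
  rw [← hlatt, Nat.cast_sub hlt.le, sub_smul]
  exact sub_eq_sub_iff_sub_eq_sub.mp h

/-! ### Uniform discreteness forces classwise rationality -/

omit [Fintype γ] in
/-- `ω₁(cls b) e_b` as a lattice vector. [folklore] -/
theorem latt_single_fst (b : γ) :
    latt L cls (Pi.single b 1) 0 = ((L (cls b)).ω₁ : ℂ) • (Pi.single b (1 : ℂ) : γ → ℂ) := by
  funext b'; by_cases h : b' = b
  · subst h; simp [latt]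
  · simp [latt, Pi.single_eq_of_ne h]

omit [Fintype γ] in
/-- `ω₂(cls b) e_b` as a lattice vector. [folklore] -/
theorem latt_single_snd (b : γ) :
    latt L cls 0 (Pi.single b 1) = ((L (cls b)).ω₂ : ℂ) • (Pi.single b (1 : ℂ) : γ → ℂ) := by
  funext b'; by_cases h : b' = b
  · subst h; simp [latt]
  · simp [latt, Pi.single_eq_of_ne h]

/-- **Uniform discreteness of `P(Λ_γ)` forces the classwise rationality of `W = ker P`** (`P` the
projection onto a coordinate complement): then `W` is cut out by its rational relations supported
in single classes. This is where `Hom(E_i, E_j) = 0` (`i ≠ j`), `End(E_i) = ℤ` (no CM) and the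
single block of the CM classes are used. [folklore] -/
theorem mem_of_forall_zRelCls (hiso : ∀ i j, i ≠ j → ¬ (L i).IsIsogenousTo (L j))
    (hcm1 : ∀ b b', cls b = cls b' → (L (cls b)).HasCM → b = b')
    {W : Submodule ℂ (γ → ℂ)} {B : Finset γ} (hc : IsCompl (cspan B) W)
    {ε : ℝ} (hε : 0 < ε)
    (hUD : ∀ m n : γ → ℤ, ‖(cspan B).projection W hc (latt L cls m n)‖ < ε →
      (cspan B).projection W hc (latt L cls m n) = 0)
    {z : γ → ℂ} (hz : ∀ i : 𝓙, ∀ c ∈ zRel W, (∀ b, cls b ≠ i → c b = 0) → ∑ b, (c b : ℂ) * z b = 0) :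
    z ∈ W := by
  classical
  set P := (cspan B).projection W hc with hP
  -- a common multiple `N` taking all `P(ω_i e_b)` into `Λ_γ`
  have h1 : ∀ b, ∃ d : ℕ, 0 < d ∧ ∃ m n : γ → ℤ, (d : ℤ) • P (latt L cls (Pi.single b 1) 0) = latt L cls m n :=
    fun b => exists_nsmul_eq_latt L cls hc hε hUD ⟨_, _, rfl⟩
  have h2 : ∀ b, ∃ d : ℕ, 0 < d ∧ ∃ m n : γ → ℤ, (d : ℤ) • P (latt L cls 0 (Pi.single b 1)) = latt L cls m n :=
    fun b => exists_nsmul_eq_latt L cls hc hε hUD ⟨_, _, rfl⟩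
  choose d₁ hd₁ m₁ n₁ hmn₁ using h1
  choose d₂ hd₂ m₂ n₂ hmn₂ using h2
  set N : ℕ := (∏ b, d₁ b) * ∏ b, d₂ b with hN
  have hNpos : 0 < N := Nat.mul_pos (Finset.prod_pos fun b _ => hd₁ b) (Finset.prod_pos fun b _ => hd₂ b)
  have hN0 : (N : ℂ) ≠ 0 := by exact_mod_cast hNpos.ne'
  have hdvd₁ : ∀ b, d₁ b ∣ N := fun b => (Finset.dvd_prod_of_mem _ (Finset.mem_univ b)).mul_right _
  have hdvd₂ : ∀ b, d₂ b ∣ N := fun b => (Finset.dvd_prod_of_mem _ (Finset.mem_univ b)).mul_left _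
  -- `x = N · P(e_b)_{b'}` has `x ω₁(cls b), x ω₂(cls b) ∈ Λ_{cls b'}`
  have hω₁ : ∀ b b', (N : ℂ) * P (Pi.single b (1 : ℂ)) b' * (L (cls b)).ω₁ ∈ (L (cls b')).lattice := by
    intro b b'
    obtain ⟨e, he⟩ := hdvd₁ b
    have h := congrArg (fun v => ((e : ℤ) • v) b') (hmn₁ b)
    rw [smul_smul, zsmul_latt, latt_single_fst, map_smul] at h
    have : (N : ℂ) * P (Pi.single b 1) b' * (L (cls b)).ω₁ =
        (((e : ℤ) * (d₁ b : ℤ)) • (((L (cls b)).ω₁ : ℂ) • P (Pi.single b 1))) b' := by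
      rw [he]; simp [Pi.smul_apply, zsmul_eq_mul]; ring
    rw [this, h]
    exact PeriodPair.mem_lattice.mpr ⟨_, _, rfl⟩
  have hω₂ : ∀ b b', (N : ℂ) * P (Pi.single b (1 : ℂ)) b' * (L (cls b)).ω₂ ∈ (L (cls b')).lattice := by
    intro b b'
    obtain ⟨e, he⟩ := hdvd₂ b
    have h := congrArg (fun v => ((e : ℤ) • v) b') (hmn₂ b)
    rw [smul_smul, zsmul_latt, latt_single_snd, map_smul] at h
    have : (N : ℂ) * P (Pi.single b 1) b' * (L (cls b)).ω₂ =
        (((e : ℤ) * (d₂ b : ℤ)) • (((L (cls b)).ω₂ : ℂ) • P (Pi.single b 1))) b' := by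
      rw [he]; simp [Pi.smul_apply, zsmul_eq_mul]; ring
    rw [this, h]
    exact PeriodPair.mem_lattice.mpr ⟨_, _, rfl⟩
  -- the entries of `P` between different classes vanish (non-isogeny)
  have hoff : ∀ b b', cls b ≠ cls b' → P (Pi.single b (1 : ℂ)) b' = 0 := by
    intro b b' hbb'
    by_contra hne
    have hx : (N : ℂ) * P (Pi.single b (1 : ℂ)) b' ≠ 0 := mul_ne_zero hN0 hne
    exact hiso _ _ hbb' (isIsogenousTo_of_mul_omega_mem hx (hω₁ b b') (hω₂ b b'))
  -- the rows of `P` annihilate `W`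
  have hroweq : ∀ x ∈ W, ∀ b', ∑ b, x b * P (Pi.single b (1 : ℂ)) b' = 0 := by
    intro x hx b'
    have : P x b' = 0 := by rw [(Submodule.projection_apply_eq_zero_iff hc).mpr hx]; rfl
    rwa [apply_eq_sum_mul] at this
  -- hence `P z = 0`, coordinate by coordinate, through classwise rational relations
  have hPz : P z = 0 := by
    funext b'
    rw [apply_eq_sum_mul, Pi.zero_apply]
    by_cases hCM : (L (cls b')).HasCM
    · -- CM class: single block, the relation `z_{b'} = 0` or nothing
      have hsingle : ∀ b, b ≠ b' → P (Pi.single b (1 : ℂ)) b' = 0 := by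
        intro b hb
        by_cases hcls : cls b = cls b'
        · exact absurd (hcm1 b b' hcls (hcls ▸ hCM)) hb
        · exact hoff b b' hcls
      rw [Finset.sum_eq_single b' (fun b _ hb => by rw [hsingle b hb, mul_zero])
        (fun h => absurd (Finset.mem_univ b') h)]
      by_cases hp : P (Pi.single b' (1 : ℂ)) b' = 0
      · rw [hp, mul_zero]
      · -- `e_{b'}` is a rational relation of `W` supported in the class of `b'`
        have hrel : (Pi.single b' (1 : ℚ) : γ → ℚ) ∈ zRel W := by
          intro x hx
          have h := hroweq x hx b'
          rw [Finset.sum_eq_single b' (fun b _ hb => by rw [hsingle b hb, mul_zero])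
            (fun h => absurd (Finset.mem_univ b') h)] at h
          have hx0 : x b' = 0 := (mul_eq_zero.mp h).resolve_right hp
          rw [Finset.sum_eq_single b' (fun b _ hb => by simp [Pi.single_eq_of_ne hb])
            (fun h => absurd (Finset.mem_univ b') h)]
          simp [hx0]
        have h0 := hz (cls b') _ hrel (fun b hb => by
          have : b ≠ b' := fun h => hb (h ▸ rfl)
          simp [Pi.single_eq_of_ne this])
        rw [Finset.sum_eq_single b' (fun b _ hb => by simp [Pi.single_eq_of_ne hb])
          (fun h => absurd (Finset.mem_univ b') h)] at h0
        simp only [Pi.single_eq_same, Rat.cast_one, one_mul] at h0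
        rw [h0, zero_mul]
    · -- no CM: the entries of the row within the class are rational
      have hcoord : ∀ b, cls b = cls b' → ∃ k : ℤ, (N : ℂ) * P (Pi.single b (1 : ℂ)) b' = k := by
        intro b hb
        refine Kron.int_of_mul_omega_mem (L (cls b')) hCM ?_ ?_
        · have := hω₁ b b'; rwa [hb] at this
        · have := hω₂ b b'; rwa [hb] at this
      have hk : ∀ b, ∃ k : ℤ, cls b = cls b' → (N : ℂ) * P (Pi.single b (1 : ℂ)) b' = k := by
        intro b
        by_cases hb : cls b = cls b'
        · obtain ⟨k, hk⟩ := hcoord b hb; exact ⟨k, fun _ => hk⟩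
        · exact ⟨0, fun h => absurd h hb⟩
      choose k hk using hk
      -- the classwise rational row
      set r : γ → ℚ := fun b => if cls b = cls b' then (k b : ℚ) / N else 0 with hr
      have hrq : ∀ b, (r b : ℂ) = P (Pi.single b (1 : ℂ)) b' := by
        intro b
        by_cases hb : cls b = cls b'
        · simp only [hr, if_pos hb]
          push_cast
          rw [← hk b hb]
          field_simp
        · simp only [hr, if_neg hb, Rat.cast_zero]
          exact (hoff b b' hb).symm
      have hrel : r ∈ zRel W := by
        intro x hx
        rw [← hroweq x hx b']
        exact Finset.sum_congr rfl fun b _ => by rw [hrq b, mul_comm]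
      have h0 := hz (cls b') r hrel (fun b hb => by simp only [hr, if_neg hb])
      rw [← h0]
      exact Finset.sum_congr rfl fun b _ => by rw [hrq b, mul_comm]
  exact (Submodule.projection_apply_eq_zero_iff hc).mp hPz

/-! ### The Kronecker lemma -/

/-- **Entire functions with `Λ_γ`-invariant zero set vanishing on `𝔷` vanish on `ratHullCls 𝔷`**
(pairwise non-isogenous lattices, CM classes with a single block). [folklore] -/
theorem eq_zero_on_ratHullCls (hiso : ∀ i j, i ≠ j → ¬ (L i).IsIsogenousTo (L j))
    (hcm1 : ∀ b b', cls b = cls b' → (L (cls b)).HasCM → b = b')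
    {g : (γ → ℂ) → ℂ} (hg : Differentiable ℂ g)
    (hper : ∀ z, g z = 0 → ∀ m n : γ → ℤ, g (z + latt L cls m n) = 0)
    (𝔷 : Submodule ℂ (γ → ℂ)) (h0 : ∀ z ∈ 𝔷, g z = 0) : ∀ z ∈ ratHullCls cls 𝔷, g z = 0 := by
  -- induction on the codimension of a subspace of the zero set containing `𝔷`
  suffices aux : ∀ (k : ℕ) (W : Submodule ℂ (γ → ℂ)), 𝔷 ≤ W → (∀ w ∈ W, g w = 0) →
      finrank ℂ (γ → ℂ) - finrank ℂ W ≤ k → ∀ z ∈ ratHullCls cls 𝔷, g z = 0 from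
    aux _ 𝔷 le_rfl h0 le_rfl
  intro k
  induction k with
  | zero =>
    intro W h𝔷W hW hk z _
    have htop : W = ⊤ := Submodule.eq_top_of_finrank_eq (le_antisymm (Submodule.finrank_le W) (by omega))
    exact hW z (htop ▸ Submodule.mem_top)
  | succ k ih =>
    intro W h𝔷W hW hk
    obtain ⟨B, hcW⟩ := exists_isCompl_cspan W
    have hc : IsCompl (cspan B) W := hcW.symm
    set P := (cspan B).projection W hc with hP
    by_cases hUD : ∃ ε : ℝ, 0 < ε ∧ ∀ m n : γ → ℤ, ‖P (latt L cls m n)‖ < ε → P (latt L cls m n) = 0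
    · -- uniformly discrete: `W` is classwise rational, `ratHullCls 𝔷 ≤ W`
      obtain ⟨ε, hε, hUD⟩ := hUD
      intro z hz
      exact hW z (ratHullCls_le_of_le cls h𝔷W
        (fun z' hz' => mem_of_forall_zRelCls L cls hiso hcm1 hc hε hUD hz') hz)
    · -- small elements: a new direction `u` in the zero set
      have hsmall : ∀ ε : ℝ, 0 < ε → ∃ s ∈ lattImage L cls P, s ≠ 0 ∧ ‖s‖ < ε := by
        intro ε hε
        by_contra h
        apply hUD
        refine ⟨ε, hε, fun m n hmn => ?_⟩
        by_contra hne
        exact h ⟨_, ⟨m, n, rfl⟩, hne, hmn⟩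
      obtain ⟨u, huB, hu0, hline⟩ := exists_line_subset_closure (lattImage L cls P) (cspan B)
        (by rintro _ ⟨m, n, rfl⟩; exact Submodule.projection_apply_mem hc _) hsmall
      have huW : u ∉ W := fun h => hu0 ((Submodule.disjoint_def.mp hc.disjoint) u huB h)
      -- the closure of `P(Λ_γ)` translated by `W` stays in the zero set
      have hT : closure (lattImage L cls P : Set (γ → ℂ)) ⊆ {v | ∀ w ∈ W, g (w + v) = 0} := by
        refine closure_minimal ?_ ?_
        · rintro _ ⟨m, n, rfl⟩ w hw
          have hdiff : latt L cls m n - P (latt L cls m n) ∈ W := by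
            rw [← Submodule.projection_apply_eq_zero_iff hc, map_sub,
              Submodule.projection_apply_of_mem_left hc (Submodule.projection_apply_mem hc _), sub_self]
          have hw' : w - (latt L cls m n - P (latt L cls m n)) ∈ W := W.sub_mem hw hdiff
          have := hper _ (hW _ hw') m n
          rwa [show w - (latt L cls m n - P (latt L cls m n)) + latt L cls m n = w + P (latt L cls m n) by abel] at this
        · have : {v : γ → ℂ | ∀ w ∈ W, g (w + v) = 0} = ⋂ w ∈ W, (fun v => g (w + v)) ⁻¹' {0} := by
            ext v; simp
          rw [this]
          exact isClosed_biInter fun w _ => isClosed_singleton.preimage (hg.continuous.comp (continuous_const.add continuous_id))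
      have hreal : ∀ w ∈ W, ∀ t : ℝ, g (w + (t : ℂ) • u) = 0 := fun w hw t => hT (hline t) w hw
      have hcx : ∀ w ∈ W, ∀ τ : ℂ, g (w + τ • u) = 0 := fun w hw τ => eq_zero_smul_of_real hg (hreal w hw) τ
      -- the bigger subspace
      set W' := W ⊔ Submodule.span ℂ {u} with hW'
      have hW'zero : ∀ w ∈ W', g w = 0 := by
        intro w hw
        obtain ⟨x, hx, v, hv, rfl⟩ := Submodule.mem_sup.mp hw
        obtain ⟨τ, rfl⟩ := Submodule.mem_span_singleton.mp hv
        exact hcx x hx τ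
      have hlt : W < W' := by
        refine lt_of_le_of_ne le_sup_left fun h => huW ?_
        rw [h]
        exact Submodule.mem_sup_right (Submodule.mem_span_singleton_self u)
      have hrank := Submodule.finrank_lt_finrank_of_lt hlt
      exact ih W' (h𝔷W.trans hlt.le) hW'zero (by omega)

end KronFam

end Literature.NumberTheory.Transcendental

end
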